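import Literature.NumberTheory.GaloisRepresentations.TateLevelOneRat
import Literature.NumberTheory.GaloisRepresentations.TateH2VanishingCorestriction
import Literature.NumberTheory.GaloisRepresentations.TateH2VanishingReduction
import Literature.NumberTheory.GaloisRepresentations.TateH2VanishingCyclotomic
import HarnessLib

/-!
# Tate's theorem `H²(G_ℚ, ℚ/ℤ) = 0` at level one, VI: descent from the Hasse principle over
# `ℚ(μ_p)` (Serre, Durham 1977, §6.5 (a), (c): "`α` is described by its local components")

Sibling proof file (theorems only) of `TateProjectiveLifting.lean`; continuation of
`TateLevelOneRat.lean`.  There it is proved (for odd `p`, `rat_exists_character_levelOne_odd`) that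
a locally constant `p`-torsion `2`-cocycle `g` on `Γ_ℚ` can be modified by the coboundary of a
locally constant cochain `c` (with `p c = φ` a Dirichlet-type character) so that `z = g - ∂c` is
*locally trivial at every finite place at level one*.  Serre's final step (§6.5 (c), first lines:
"an element `α ∈ Br_p(K)` is described by its local components", the Hasse principle part of the
Albert–Brauer–Hasse–Noether theorem for `K = ℚ(μ_p)`) is isolated here as the hypothesis
`HI` — **the Hasse input at `p`**: for `K = ℚ(μ_p)` (`CyclotomicField p ℚ`) and the restriction
`Γ_K → Γ_ℚ` (`absGaloisRestrict`), a locally constant `p`-torsion `2`-cocycle `z` on `Γ_ℚ` which is a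
locally constant `p`-torsion coboundary on every decomposition group `Γ_{ℚ_v} → Γ_ℚ` pulls back to
the coboundary of a locally constant cochain on `Γ_K` — and the descent from it is carried out:

* `twoCocycle_addCircle_split_of_split_on_subgroup_coprime` — Serre §6.5 (a), second paragraph,
  per cocycle: if `g|_S = ∂c` on a closed subgroup `S` of index prime to `p`, then `g = ∂b` on `G`
  (`cor ∘ res = (G : S)`, the argument of `twoCocycle_addCircle_prime_split_of_subgroup_coprime`);
* `exists_coboundary_on_subgroup_of_continuousMulEquiv` — transport of a splitting along
  `Γ_K ≃ₜ* Gal(ℚ̄/K) ≤ Γ_ℚ`;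
* `twoCocycle_addCircle_prime_split_rat_of_hasseInput_odd` — **`(H_p)(Γ_ℚ)` for odd `p` from the
  Hasse input at `p`**: `z = g - ∂c` is locally trivial (`rat_exists_character_levelOne_odd`),
  hence splits on `Γ_K` (`HI`), i.e. on `Gal(ℚ̄/K) ≤ Γ_ℚ`, of index `p - 1`; hence `z = ∂b` on `Γ_ℚ`,
  and `g = ∂(b + c)`;
* `Tate_projectiveLifting_of_hasseInput` — **`Tate_projectiveLifting`** from the Hasse inputs at
  all odd `p` and the prime-`2` statement `(H_2)(Γ_ℚ)` (treated in the sequel through `ℚ(i)`).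

The Hasse input is a consequence of the Hasse principle for `H²(K, K̄ˣ)`, `K = ℚ(μ_p)` (cochain
form, as in `EllipticCurves/PeriodIndexObstructionBaseChange.lean`), by Hilbert 90; that deduction
(local conditions at the places of `K` from those at the places of `ℚ`) is not made here.

## References

* J.-P. Serre, *Modular forms of weight one and Galois representations* (Durham 1977), §6.5 (a),
  (c). [SerreDurham1977]
* J.-P. Serre, *Galois Cohomology* (1997), I §2.4 Prop. 9 and Cor. [SerreGaloisCohomology1997]
-/

noncomputable section

open Field ValuativeRel IsDedekindDomain
open scoped Pointwise NumberField

namespace Literature.NumberTheory.GaloisRepresentations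

open _root_.TopRep _root_.ContRepresentation _root_.ContinuousCohomology

/-! ### `cor ∘ res = (G : S)`, per cocycle -/

section CorReduction

variable {G : Type} [Group G] [TopologicalSpace G] [IsTopologicalGroup G] [CompactSpace G]
  [T2Space G] [TotallyDisconnectedSpace G]

/-- **"`Res` is injective for index prime to `p`", per cocycle** (Serre §6.5 (a), second
paragraph): let `G` be profinite, `S` a closed subgroup of index prime to the prime `p`, and `g` a
locally constant `p`-torsion `2`-cocycle `G × G → ℚ/ℤ` whose restriction to `S` is the coboundary
of a locally constant cochain.  Then `g` is the coboundary of a locally constant cochain on `G`.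
(Same proof as `twoCocycle_addCircle_prime_split_of_subgroup_coprime`: in `H²(G, ℤ/N)`,
`N = pM`, `res [g] = 0`, `(G : S)[g] = cor res [g] = 0` and `p [g] = 0`, so `[g] = 0`.)
[cite: SerreDurham1977, §6.5 (a)] [cite: SerreGaloisCohomology1997, I §2.4 Prop. 9 and Cor.] -/
theorem twoCocycle_addCircle_split_of_split_on_subgroup_coprime {p : ℕ} (hp : p.Prime)
    (S : Subgroup G) (hS : IsClosed (S : Set G)) (hidx : p.Coprime S.index)
    (g : G → G → AddCircle (1 : ℚ)) (hg : IsLocallyConstant (Function.uncurry g))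
    (hcoc : ∀ σ τ υ, g σ τ + g (σ * τ) υ = g τ υ + g σ (τ * υ)) (hpg : ∀ σ τ, p • g σ τ = 0)
    (HS : ∃ c : S → AddCircle (1 : ℚ), IsLocallyConstant c ∧
      ∀ s t : S, g s t + c (s * t) = c s + c t) :
    ∃ b : G → AddCircle (1 : ℚ), IsLocallyConstant b ∧ ∀ σ τ, g σ τ + b (σ * τ) = b σ + b τ := by
  classical
  haveI : IsClosed (S : Set G) := hS
  haveI : CompactSpace S := isCompact_iff_compactSpace.mp hS.isCompact
  have hidx0 : S.index ≠ 0 := by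
    intro h0
    rw [h0, Nat.coprime_zero_right] at hidx
    exact hp.one_lt.ne' hidx
  haveI : Fintype (G ⧸ S) := Subgroup.fintypeOfIndexNeZero hidx0
  -- Step 1: the restriction of `g` to `S` splits, `g|_S = ∂c`
  obtain ⟨c, hc_lc, hc⟩ := HS
  -- Step 2: a common denominator `N = p M` for the values of `g` and `c`
  obtain ⟨M, hM0, hMc⟩ := addCircle_exists_nsmul_comp_eq_zero c hc_lc.range_finite
  set N : ℕ := p * M with hN_def
  have hN0 : 0 < N := Nat.mul_pos hp.pos hM0
  have hNg : ∀ σ τ, N • g σ τ = 0 := fun σ τ => by rw [hN_def, mul_nsmul, hpg, nsmul_zero]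
  have hNc : ∀ s, N • c s = 0 := fun s => by rw [hN_def, mul_nsmul', hMc, nsmul_zero]
  obtain ⟨e, he_inj, -, he_surj⟩ := zmod_exists_addMonoidHom_addCircle hN0
  have hpre : ∀ x : AddCircle (1 : ℚ), ∃ k : ZMod N, N • x = 0 → e k = x := fun x => by
    by_cases hx : N • x = 0
    · obtain ⟨k, hk⟩ := he_surj x hx
      exact ⟨k, fun _ => hk⟩
    · exact ⟨0, fun h => absurd h hx⟩
  choose ψ hψ using hpre
  -- Step 3: the `ℤ/N`-valued continuous cocycle and its class in `H²(G, ℤ/N)`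
  set ρ : ContinuousRep G ℤ (ZMod N) := ContinuousRep.trivial G ℤ (ZMod N) with hρ_def
  set gN : C(G × G, ZMod N) := ⟨ψ ∘ Function.uncurry g, (hg.comp ψ).continuous⟩ with hgN_def
  have hgNe : ∀ σ τ, e (gN (σ, τ)) = g σ τ := fun σ τ => hψ _ (hNg σ τ)
  have hgN_mem : gN ∈ contTwoCocycles ρ.toTopRep := by
    rw [mem_contTwoCocycles_iff]
    intro σ τ υ
    change gN (τ, υ) + gN (σ, τ * υ) = gN (σ * τ, υ) + gN (σ, τ)
    apply he_inj
    rw [map_add, map_add, hgNe, hgNe, hgNe, hgNe, add_comm (g (σ * τ) υ), hcoc]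
  set γ : contTwoCocycles ρ.toTopRep := ⟨gN, hgN_mem⟩ with hγ_def
  -- `p • [γ] = 0`
  have hpγ : p • γ = 0 := by
    refine Subtype.ext (ContinuousMap.ext fun x => ?_)
    obtain ⟨σ, τ⟩ := x
    change p • gN (σ, τ) = 0
    apply he_inj
    rw [map_nsmul, map_zero, hgNe, hpg]
  have hpcl : p • twoCocycleClass ρ.toTopRep γ = 0 := by
    have h := (map_nsmul (twoCocycleClassₗ ρ.toTopRep) p γ).symm
    rw [hpγ, map_zero] at h
    exact h
  -- `res [γ] = 0`: the restricted cocycle is `∂(ψ ∘ c)`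
  have hres : resH S ρ 2 (twoCocycleClass ρ.toTopRep γ) = 0 := by
    rw [resH_twoCocycleClass, twoCocycleClass_eq_zero_iff]
    refine ⟨⟨ψ ∘ c, (hc_lc.comp ψ).continuous⟩, fun s t => ?_⟩
    change gN ((s : G), (t : G)) = ψ (c t) - ψ (c (s * t)) + ψ (c s)
    apply he_inj
    rw [hgNe, map_add, map_sub, hψ _ (hNc _), hψ _ (hNc _), hψ _ (hNc _), ← sub_eq_zero]
    have e2 : g s t - (c t - c (s * t) + c s) = g s t + c (s * t) - (c s + c t) := by abel
    rw [e2, hc, sub_self]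
  -- `(G : S) • [γ] = cor (res [γ]) = 0`
  have hicl : S.index • twoCocycleClass ρ.toTopRep γ = 0 := by
    rw [← cor_resH S ρ 1, hres, map_zero]
  -- Bézout: `[γ] = 0`
  have hcl : twoCocycleClass ρ.toTopRep γ = 0 := by
    obtain ⟨u, v, huv⟩ := Nat.isCoprime_iff_coprime.2 hidx
    set x := twoCocycleClass ρ.toTopRep γ
    have hp' : (p : ℤ) • x = 0 := by rw [natCast_zsmul, hpcl]
    have hi' : (S.index : ℤ) • x = 0 := by rw [natCast_zsmul, hicl]
    calc x = (1 : ℤ) • x := (one_zsmul x).symm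
      _ = (u * p + v * S.index : ℤ) • x := by rw [huv]
      _ = 0 := by rw [add_zsmul, mul_zsmul, mul_zsmul, hp', hi', zsmul_zero, zsmul_zero, add_zero]
  -- Step 4: `γ = ∂b` with `b : G → ℤ/N` continuous; push back into `ℚ/ℤ`
  obtain ⟨b, hb⟩ := (twoCocycleClass_eq_zero_iff ρ.toTopRep γ).1 hcl
  have hb_lc : IsLocallyConstant (b : G → ZMod N) :=
    (IsLocallyConstant.iff_continuous _).2 b.continuous
  refine ⟨e ∘ b, hb_lc.comp e, fun σ τ => ?_⟩
  have h := hb σ τ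
  change gN (σ, τ) = b τ - b (σ * τ) + b σ at h
  have h' := congrArg e h
  rw [hgNe, map_add, map_sub] at h'
  simp only [Function.comp_apply]
  rw [h']
  abel

end CorReduction

/-! ### Transport of a splitting along `Γ_K ≃ₜ* range (Γ_K → Γ_ℚ)` -/

section Transport

variable {G : Type*} [Group G] [TopologicalSpace G]
variable {H : Type*} [Group H] [TopologicalSpace H]

/-- If the pull-back of a cocycle `g` on `G` along an isomorphism of topological groups
`e : H ≃ₜ* S` onto a subgroup `S ≤ G` is the coboundary of a locally constant cochain on `H`, then
the restriction of `g` to `S` is the coboundary of a locally constant cochain. [folklore] -/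
theorem exists_coboundary_on_subgroup_of_continuousMulEquiv (S : Subgroup G) (e : H ≃ₜ* S)
    (g : G → G → AddCircle (1 : ℚ)) {b : H → AddCircle (1 : ℚ)} (hb_lc : IsLocallyConstant b)
    (hb : ∀ σ τ, g ((e σ : S) : G) ((e τ : S) : G) + b (σ * τ) = b σ + b τ) :
    ∃ c : S → AddCircle (1 : ℚ), IsLocallyConstant c ∧ ∀ s t : S, g s t + c (s * t) = c s + c t := by
  refine ⟨b ∘ e.symm, hb_lc.comp_continuous (map_continuous e.symm), fun s t => ?_⟩
  have h := hb (e.symm s) (e.symm t)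
  simp only [ContinuousMulEquiv.apply_symm_apply, ← map_mul] at h
  simpa only [Function.comp_apply, map_mul] using h

end Transport

/-! ### `(H_p)(Γ_ℚ)` for odd `p` from the Hasse input -/

section Rat

/-- **`H²(G_ℚ, ℚ_p/ℤ_p) = 0` (cochain form) for odd `p`, from the Hasse input at `p`** (Serre, Durham
§6.5 (c) over `ℚ`).  Hypothesis `HI` (the Hasse input at `p`, = Hasse principle for
`Br(ℚ(μ_p))[p]` on classes from `ℚ`, via `H²(·, ℤ/p) ≅ H²(·, μ_p) ↪ Br` over `ℚ(μ_p)` and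
Hilbert 90): for `K = ℚ(μ_p)` (`CyclotomicField p ℚ`), every locally constant `p`-torsion
`2`-cocycle `z : Γ_ℚ × Γ_ℚ → ℚ/ℤ` which is, at every finite place `v`, the coboundary on `Γ_{ℚ_v}` of
a locally constant `p`-torsion cochain, pulls back along `Γ_K → Γ_ℚ` to the coboundary of a locally
constant cochain.  Conclusion: every locally constant `p`-torsion `2`-cocycle `g` on `Γ_ℚ` is the
coboundary of a locally constant cochain.  Proof: `z = g - ∂c` with `p c = φ` Serre's global
Dirichlet character (`rat_exists_character_levelOne_odd`) is locally trivial at level one at all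
finite places; by `HI` it splits on `Γ_K ≅ Gal(ℚ̄/K) ≤ Γ_ℚ`, a closed subgroup of index
`[K : ℚ] = p - 1`; by `cor ∘ res` it splits on `Γ_ℚ`
(`twoCocycle_addCircle_split_of_split_on_subgroup_coprime`); so does `g = z + ∂c`.
[cite: SerreDurham1977, §6.5 (a), (c)] -/
theorem twoCocycle_addCircle_prime_split_rat_of_hasseInput_odd {p : ℕ} (hp : p.Prime)
    (hp2 : p ≠ 2)
    (HI : ∀ z : absoluteGaloisGroup ℚ → absoluteGaloisGroup ℚ → AddCircle (1 : ℚ),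
      IsLocallyConstant (Function.uncurry z) →
      (∀ σ τ υ, z σ τ + z (σ * τ) υ = z τ υ + z σ (τ * υ)) → (∀ σ τ, p • z σ τ = 0) →
      (∀ v : HeightOneSpectrum (𝓞 ℚ),
        ∃ β : absoluteGaloisGroup (v.adicCompletion ℚ) → AddCircle (1 : ℚ), IsLocallyConstant β ∧
          (∀ σ τ, z (absGaloisRestrict ℚ (v.adicCompletion ℚ) σ)
              (absGaloisRestrict ℚ (v.adicCompletion ℚ) τ) + β (σ * τ) = β σ + β τ) ∧
          ∀ σ, p • β σ = 0) →
      ∃ b : absoluteGaloisGroup (CyclotomicField p ℚ) → AddCircle (1 : ℚ), IsLocallyConstant b ∧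
        ∀ σ τ, z (absGaloisRestrict ℚ (CyclotomicField p ℚ) σ)
            (absGaloisRestrict ℚ (CyclotomicField p ℚ) τ) + b (σ * τ) = b σ + b τ)
    (g : absoluteGaloisGroup ℚ → absoluteGaloisGroup ℚ → AddCircle (1 : ℚ))
    (hg : IsLocallyConstant (Function.uncurry g))
    (hcoc : ∀ σ τ υ, g σ τ + g (σ * τ) υ = g τ υ + g σ (τ * υ)) (hpg : ∀ σ τ, p • g σ τ = 0) :
    ∃ b : absoluteGaloisGroup ℚ → AddCircle (1 : ℚ), IsLocallyConstant b ∧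
      ∀ σ τ, g σ τ + b (σ * τ) = b σ + b τ := by
  haveI : CompactSpace (absoluteGaloisGroup ℚ) := absoluteGaloisGroup_compactSpace ℚ
  -- Serre's global character: `z = g - ∂c` is locally trivial at level one at every finite place
  obtain ⟨φ, c, -, hφ_add, hc_lc, hpc, hloc⟩ := rat_exists_character_levelOne_odd hp hp2 g hg hcoc hpg
  set z : absoluteGaloisGroup ℚ → absoluteGaloisGroup ℚ → AddCircle (1 : ℚ) :=
    fun σ τ => g σ τ - (c σ + c τ - c (σ * τ)) with hz_def
  have hz_lc : IsLocallyConstant (Function.uncurry z) := by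
    have h1 : IsLocallyConstant fun x : absoluteGaloisGroup ℚ × absoluteGaloisGroup ℚ => c x.1 :=
      hc_lc.comp_continuous continuous_fst
    have h2 : IsLocallyConstant fun x : absoluteGaloisGroup ℚ × absoluteGaloisGroup ℚ => c x.2 :=
      hc_lc.comp_continuous continuous_snd
    have h3 : IsLocallyConstant fun x : absoluteGaloisGroup ℚ × absoluteGaloisGroup ℚ =>
        c (x.1 * x.2) := hc_lc.comp_continuous (continuous_fst.mul continuous_snd)
    rw [show Function.uncurry z = fun x : absoluteGaloisGroup ℚ × absoluteGaloisGroup ℚ =>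
      Function.uncurry g x - (c x.1 + c x.2 - c (x.1 * x.2)) from rfl]
    exact hg.comp₂ ((h1.comp₂ h2 fun a b => a + b).comp₂ h3 fun a b => a - b) fun a b => a - b
  have hz_coc : ∀ σ τ υ, z σ τ + z (σ * τ) υ = z τ υ + z σ (τ * υ) := fun σ τ υ => by
    simp only [hz_def, mul_assoc]
    have h := hcoc σ τ υ
    rw [← sub_eq_zero] at h ⊢
    rw [← h]
    abel
  have hz_p : ∀ σ τ, p • z σ τ = 0 := fun σ τ => by
    simp only [hz_def, nsmul_sub, nsmul_add, hpg, hpc, hφ_add, sub_self]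
  have hz_loc : ∀ v : HeightOneSpectrum (𝓞 ℚ),
      ∃ β : absoluteGaloisGroup (v.adicCompletion ℚ) → AddCircle (1 : ℚ), IsLocallyConstant β ∧
        (∀ σ τ, z (absGaloisRestrict ℚ (v.adicCompletion ℚ) σ)
            (absGaloisRestrict ℚ (v.adicCompletion ℚ) τ) + β (σ * τ) = β σ + β τ) ∧
        ∀ σ, p • β σ = 0 := fun v => by
    obtain ⟨β, hβ_lc, hβ, hβp⟩ := hloc v
    refine ⟨β, hβ_lc, fun σ τ => ?_, hβp⟩
    have h := hβ σ τ
    rw [map_mul] at h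
    exact h
  -- the Hasse input: `z` splits on `Γ_K`, `K = ℚ(μ_p)`
  obtain ⟨b', hb'_lc, hb'⟩ := HI z hz_lc hz_coc hz_p hz_loc
  -- transport to the closed subgroup `Gal(ℚ̄/K) ≤ Γ_ℚ`, of index `[K : ℚ] = p - 1`
  haveI : Fact p.Prime := ⟨hp⟩
  haveI : NeZero p := ⟨hp.ne_zero⟩
  haveI : IsCyclotomicExtension {p} ℚ (CyclotomicField p ℚ) :=
    CyclotomicField.isCyclotomicExtension p ℚ
  haveI : NumberField (CyclotomicField p ℚ) :=
    IsCyclotomicExtension.numberField {p} ℚ (CyclotomicField p ℚ)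
  set S : Subgroup (absoluteGaloisGroup ℚ) :=
    (absGaloisRestrict ℚ (CyclotomicField p ℚ) :
      absoluteGaloisGroup (CyclotomicField p ℚ) →* absoluteGaloisGroup ℚ).range with hS_def
  have hSclosed : IsClosed (S : Set (absoluteGaloisGroup ℚ)) := by
    rw [hS_def, MonoidHom.coe_range]
    exact isClosed_range_absGaloisRestrict ℚ (CyclotomicField p ℚ)
  have hSidx : S.index = p - 1 := by
    rw [hS_def, ← Nat.totient_prime hp, ← IsCyclotomicExtension.finrank (CyclotomicField p ℚ)
      (Polynomial.cyclotomic.irreducible_rat hp.pos)]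
    exact index_range_absGaloisRestrict_eq_finrank ℚ (CyclotomicField p ℚ)
  have hcop : p.Coprime S.index := by
    rw [hSidx, Nat.Prime.coprime_iff_not_dvd hp]
    exact Nat.not_dvd_of_pos_of_lt (Nat.sub_pos_of_lt hp.one_lt) (Nat.sub_lt hp.pos one_pos)
  let e : absoluteGaloisGroup (CyclotomicField p ℚ) ≃ₜ* S :=
    continuousMulEquivRangeOfInjective (absGaloisRestrict ℚ (CyclotomicField p ℚ))
      (absGaloisRestrict_injective ℚ (CyclotomicField p ℚ))
  have HS := exists_coboundary_on_subgroup_of_continuousMulEquiv S e z hb'_lc (fun σ τ => hb' σ τ)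
  -- `cor ∘ res`: `z` splits on `Γ_ℚ`
  obtain ⟨b, hb_lc, hb⟩ := twoCocycle_addCircle_split_of_split_on_subgroup_coprime hp S hSclosed
    hcop z hz_lc hz_coc hz_p HS
  -- hence so does `g = z + ∂c`
  refine ⟨fun σ => b σ + c σ, hb_lc.comp₂ hc_lc fun x y => x + y, fun σ τ => ?_⟩
  have h := hb σ τ
  show g σ τ + (b (σ * τ) + c (σ * τ)) = (b σ + c σ) + (b τ + c τ)
  have e1 : g σ τ + (b (σ * τ) + c (σ * τ)) = (z σ τ + b (σ * τ)) + (c σ + c τ) := by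
    simp only [hz_def]
    abel
  rw [e1, h]
  abel

/-- **`Tate_projectiveLifting` from the Hasse inputs at the odd primes and `(H_2)(Γ_ℚ)`.**  The
named fact `Tate_projectiveLifting` (Serre, Durham 1977, §6.1 Cor. to Thm. 4) follows from:
for every odd prime `p`, the Hasse input at `p` (hypothesis of
`twoCocycle_addCircle_prime_split_rat_of_hasseInput_odd`: Serre §6.5 (c), first lines — the Hasse
principle for `Br_p(ℚ(μ_p))` on classes from `ℚ`, cochain form), and for `p = 2` the cochain
statement `(H_2)(Γ_ℚ)` (every locally constant `2`-torsion `2`-cocycle on `Γ_ℚ` with values in `ℚ/ℤ`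
is the coboundary of a locally constant cochain).  All other ingredients of Serre's proof — Tate's
local theorems, the finiteness of the support, the global Dirichlet character, `cor ∘ res` — are
theorems of the tree (`TateLevelOne*.lean`, `TateLocalH2Vanishing.lean`, `TateH2Vanishing*.lean`).
[cite: SerreDurham1977, §6.1 Cor. to Thm. 4, §6.5] -/
theorem Tate_projectiveLifting_of_hasseInput
    (HI : ∀ p : ℕ, p.Prime → p ≠ 2 →
      ∀ z : absoluteGaloisGroup ℚ → absoluteGaloisGroup ℚ → AddCircle (1 : ℚ),
      IsLocallyConstant (Function.uncurry z) →
      (∀ σ τ υ, z σ τ + z (σ * τ) υ = z τ υ + z σ (τ * υ)) → (∀ σ τ, p • z σ τ = 0) →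
      (∀ v : HeightOneSpectrum (𝓞 ℚ),
        ∃ β : absoluteGaloisGroup (v.adicCompletion ℚ) → AddCircle (1 : ℚ), IsLocallyConstant β ∧
          (∀ σ τ, z (absGaloisRestrict ℚ (v.adicCompletion ℚ) σ)
              (absGaloisRestrict ℚ (v.adicCompletion ℚ) τ) + β (σ * τ) = β σ + β τ) ∧
          ∀ σ, p • β σ = 0) →
      ∃ b : absoluteGaloisGroup (CyclotomicField p ℚ) → AddCircle (1 : ℚ), IsLocallyConstant b ∧
        ∀ σ τ, z (absGaloisRestrict ℚ (CyclotomicField p ℚ) σ)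
            (absGaloisRestrict ℚ (CyclotomicField p ℚ) τ) + b (σ * τ) = b σ + b τ)
    (H2 : ∀ g : absoluteGaloisGroup ℚ → absoluteGaloisGroup ℚ → AddCircle (1 : ℚ),
      IsLocallyConstant (Function.uncurry g) →
      (∀ σ τ υ, g σ τ + g (σ * τ) υ = g τ υ + g σ (τ * υ)) → (∀ σ τ, 2 • g σ τ = 0) →
      ∃ c : absoluteGaloisGroup ℚ → AddCircle (1 : ℚ), IsLocallyConstant c ∧
        ∀ σ τ, g σ τ + c (σ * τ) = c σ + c τ) :
    Tate_projectiveLifting := by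
  refine Tate_projectiveLifting_of_forall_prime fun p hp => ?_
  by_cases hp2 : p = 2
  · subst hp2
    exact H2
  · exact twoCocycle_addCircle_prime_split_rat_of_hasseInput_odd hp hp2 (HI p hp hp2)

end Rat

end Literature.NumberTheory.GaloisRepresentations

end
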